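import Mathlib
import Literature.Algebra.Polynomial.GramMatrixMethod
import Literature.Algebra.Polynomial.RationalSosRounding
import HarnessLib

/-!
# Exact SOS certificates from rounded Gram matrices: the polynomial end of Peyrl–Parrilo

This file instantiates the class-map formalisation of [PeyrlParrilo2008, Prop. 7–8]
(`Literature.Algebra.Polynomial.RationalSosRounding`) at the SOS constraints
`Σ_{β+γ=α} Q_{βγ} = p_α` [PeyrlParrilo2008, (6)] = [Laurent2008, (3.4)] and combines it with the
Gram-matrix method (`Literature.Algebra.Polynomial.GramMatrixMethod`):

* `addCls S β γ = β + γ` on a finite exponent set `S`; `classSum (addCls S) Q α` is the coefficient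
  of `x^α` in `z_Sᵀ Q z_S` (`classSum_addCls`), so `Q ∈ L` iff `z_Sᵀ Q z_S = p`
  (`mem_gramAffineSpace_addCls_iff`), and the solvability-on-empty-classes condition of Prop. 7 is
  `supp p ⊆ S + S` (`coeff_eq_zero_of_classCount_addCls_eq_zero`).
* **End-to-end statement** [PeyrlParrilo2008, Prop. 8 with Thm 2]: under the hypotheses of Prop. 8
  the rounded-and-projected matrix `Π(Q̃)` is an exact Gram matrix of `p`, so `p ≥ 0` pointwise over
  any linearly ordered field with trivial involution (`eval_nonneg_of_rounding`, e.g. `ℚ`) and `p` is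
  a sum of squares over `ℝ` (`isSumSq_of_rounding`).
* The a-posteriori form a verifier checks (no `ε, δ, τ`): an exact `Q ∈ L` with `Q ⪰ 0` proves
  `p ≥ 0` (`eval_nonneg_of_mem_gramAffineSpace`) and, over `ℝ`, `IsSumSq p`
  (`isSumSq_of_mem_gramAffineSpace`).

## References

* [PeyrlParrilo2008] H. Peyrl, P. A. Parrilo, Theoret. Comput. Sci. 409 (2008) 269–281, (6), Thm 2,
  Prop. 7, Prop. 8.
* [Laurent2008] M. Laurent, Sums of squares, moment matrices and optimization over polynomials,
  IMA Vol. 149 (2009), §3.3 (3.4).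
-/

noncomputable section

open MvPolynomial Matrix Finset

open scoped BigOperators

namespace Literature.Algebra.Polynomial.RationalSosCertificate

open GramMatrixMethod RationalSosRounding

universe u v

variable {σ : Type u} {𝕜 : Type v} [Field 𝕜]

/-- The SOS class map on a finite set `S` of exponents: the entry `(β, γ)` of a Gram matrix
contributes to the coefficient of `x^{β+γ}`. [cite: PeyrlParrilo2008, §2.2.2 (6)] -/
def addCls (S : Finset (σ →₀ ℕ)) : S → S → (σ →₀ ℕ) := fun β γ => β.1 + γ.1

omit [Field 𝕜] in
/-- The SOS classes are symmetric. [cite: PeyrlParrilo2008, §2.2.2 (6)] -/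
theorem addCls_comm (S : Finset (σ →₀ ℕ)) (β γ : S) : addCls S β γ = addCls S γ β :=
  add_comm _ _

/-- **Class sums are coefficients**: `Σ_{β+γ=α} Q_{βγ}` is the coefficient of `x^α` in `z_Sᵀ Q z_S`.
[cite: PeyrlParrilo2008, §2.2.2 (3) and (6)] -/
theorem classSum_addCls [DecidableEq σ] (S : Finset (σ →₀ ℕ)) (Q : Matrix S S 𝕜) (α : σ →₀ ℕ) :
    classSum (addCls S) Q α = coeff α (gramPoly Q (monomialVec S)) := by
  rw [coeff_gramPoly_monomialVec]
  rfl

/-- **`L` is the set of exact Gram matrices of `p`**: `Q ∈ L ↔ z_Sᵀ Q z_S = p`.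
[cite: PeyrlParrilo2008, §2.2.2 (6)] -/
theorem mem_gramAffineSpace_addCls_iff [DecidableEq σ] (S : Finset (σ →₀ ℕ)) (Q : Matrix S S 𝕜)
    (p : MvPolynomial σ 𝕜) :
    Q ∈ gramAffineSpace (addCls S) (fun α => coeff α p) ↔ gramPoly Q (monomialVec S) = p := by
  simp only [gramAffineSpace, Set.mem_setOf_eq, classSum_addCls]
  exact ⟨fun h => MvPolynomial.ext _ _ h, fun h α => by rw [h]⟩

/-- **Solvability on empty classes = `supp p ⊆ S + S`**: if every monomial of `p` is a sum of two
exponents of `S`, then `p_α = 0` whenever no pair of `S` sums to `α`.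
[cite: PeyrlParrilo2008, §2.2.1 Thm 2 (C(p) ⊆ ½C(p) + ½C(p))] -/
theorem coeff_eq_zero_of_classCount_addCls_eq_zero [DecidableEq σ] (S : Finset (σ →₀ ℕ))
    {p : MvPolynomial σ 𝕜} (hp : ∀ α ∈ p.support, ∃ β ∈ S, ∃ γ ∈ S, β + γ = α) (α : σ →₀ ℕ)
    (h : classCount (addCls S) α = 0) : coeff α p = 0 := by
  by_contra hne
  obtain ⟨β, hβ, γ, hγ, hβγ⟩ := hp α (mem_support_iff.2 hne)
  have hmem : (⟨β, hβ⟩, ⟨γ, hγ⟩) ∈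
      (Finset.univ.filter fun ij : S × S => addCls S ij.1 ij.2 = α) :=
    Finset.mem_filter.2 ⟨Finset.mem_univ _, hβγ⟩
  rw [classCount, Finset.card_eq_zero] at h
  exact Finset.notMem_empty _ (h ▸ hmem)

section Ordered

variable [LinearOrder 𝕜] [IsStrictOrderedRing 𝕜] [StarRing 𝕜] [TrivialStar 𝕜]

omit [IsStrictOrderedRing 𝕜] in
/-- **A-posteriori certificate check** (what an exact verifier does): an exact Gram matrix `Q ∈ L`
of `p` that is positive semidefinite proves `p(x) ≥ 0` at every point, over any linearly ordered
field with trivial involution. [cite: PeyrlParrilo2008, §2.2.1 Thm 2] -/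
theorem eval_nonneg_of_mem_gramAffineSpace [DecidableEq σ] (S : Finset (σ →₀ ℕ))
    {p : MvPolynomial σ 𝕜} {Q : Matrix S S 𝕜}
    (hL : Q ∈ gramAffineSpace (addCls S) (fun α => coeff α p)) (hQ : Q.PosSemidef) (x : σ → 𝕜) :
    0 ≤ eval x p := by
  rw [← (mem_gramAffineSpace_addCls_iff S Q p).1 hL]
  exact eval_gramPoly_nonneg_of_posSemidef hQ _ x

/-- **[PeyrlParrilo2008, Prop. 8 ⇒ Thm 2], end to end over an ordered field.**  Let `supp p ⊆ S + S`,
let `Q ⪰ ε I` (`ε ≥ 0`) with `d(Q, Π(Q))² ≤ δ²` (numerical Gram matrix), `Q̃` symmetric with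
`d(Q̃, Q)² ≤ τ²` (its rational rounding) and `τ² + δ² ≤ ε²`.  Then `Π(Q̃)` is an exact positive
semidefinite Gram matrix of `p`: `z_Sᵀ Π(Q̃) z_S = p` and `p(x) ≥ 0` for all `x`.
[cite: PeyrlParrilo2008, §3.1 Prop. 8] -/
theorem eval_nonneg_of_rounding [DecidableEq σ] (S : Finset (σ →₀ ℕ)) {p : MvPolynomial σ 𝕜}
    (hp : ∀ α ∈ p.support, ∃ β ∈ S, ∃ γ ∈ S, β + γ = α) {Q Q' : Matrix S S 𝕜} {ε δ τ : 𝕜}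
    (hε : 0 ≤ ε) (hQε : (Q - ε • (1 : Matrix S S 𝕜)).PosSemidef) (hQ' : Q'.IsHermitian)
    (hδ : frobSq (Q - proj (addCls S) (fun α => coeff α p) Q) ≤ δ ^ 2)
    (hτ : frobSq (Q' - Q) ≤ τ ^ 2) (h : τ ^ 2 + δ ^ 2 ≤ ε ^ 2) :
    gramPoly (proj (addCls S) (fun α => coeff α p) Q') (monomialVec S) = p ∧
      (proj (addCls S) (fun α => coeff α p) Q').PosSemidef ∧ ∀ x, 0 ≤ eval x p := by
  obtain ⟨hpsd, hL⟩ := posSemidef_proj_of_rounding (addCls_comm S)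
    (coeff_eq_zero_of_classCount_addCls_eq_zero S hp) hε hQε hQ' hδ hτ h
  exact ⟨(mem_gramAffineSpace_addCls_iff S _ p).1 hL, hpsd,
    eval_nonneg_of_mem_gramAffineSpace S hL hpsd⟩

end Ordered

/-- Over `ℝ`, an exact positive semidefinite Gram matrix `Q ∈ L` makes `p` a sum of squares.
[cite: PeyrlParrilo2008, §2.2.1 Thm 2] -/
theorem isSumSq_of_mem_gramAffineSpace [DecidableEq σ] (S : Finset (σ →₀ ℕ))
    {p : MvPolynomial σ ℝ} {Q : Matrix S S ℝ}
    (hL : Q ∈ gramAffineSpace (addCls S) (fun α => coeff α p)) (hQ : Q.PosSemidef) : IsSumSq p := by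
  rw [← (mem_gramAffineSpace_addCls_iff S Q p).1 hL]
  exact isSumSq_gramPoly_of_posSemidef hQ _

/-- **[PeyrlParrilo2008, Prop. 8], end to end over `ℝ`**: under the hypotheses of Prop. 8 the
rounded-and-projected Gram matrix exhibits `p` as a sum of squares of real polynomials.
[cite: PeyrlParrilo2008, §3.1 Prop. 8] -/
theorem isSumSq_of_rounding [DecidableEq σ] (S : Finset (σ →₀ ℕ)) {p : MvPolynomial σ ℝ}
    (hp : ∀ α ∈ p.support, ∃ β ∈ S, ∃ γ ∈ S, β + γ = α) {Q Q' : Matrix S S ℝ} {ε δ τ : ℝ}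
    (hε : 0 ≤ ε) (hQε : (Q - ε • (1 : Matrix S S ℝ)).PosSemidef) (hQ' : Q'.IsHermitian)
    (hδ : frobSq (Q - proj (addCls S) (fun α => coeff α p) Q) ≤ δ ^ 2)
    (hτ : frobSq (Q' - Q) ≤ τ ^ 2) (h : τ ^ 2 + δ ^ 2 ≤ ε ^ 2) : IsSumSq p := by
  obtain ⟨hpsd, hL⟩ := posSemidef_proj_of_rounding (addCls_comm S)
    (coeff_eq_zero_of_classCount_addCls_eq_zero S hp) hε hQε hQ' hδ hτ h
  exact isSumSq_of_mem_gramAffineSpace S hL hpsd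

end Literature.Algebra.Polynomial.RationalSosCertificate
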